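import Literature.Topology.FourManifolds.TrisectionsImplantFaceTransport
import Literature.Topology.FourManifolds.TrisectionsJointChart
import Literature.Topology.FourManifolds.MorseTurnAbout
import Literature.Topology.FourManifolds.FlowFibreMorseAlgebra
import HarnessLib

/-!
# Faces through the implant: shear charts and the Morse data of a graph face

Topic `Literature/Topology/FourManifolds`; infrastructure for the fact seat
`provefact-Literature.Topology.FourManifolds.exists-14560f9fc8` (named fact (c′)
`Literature.Topology.FourManifolds.exists_stabilized_gkTrisection`, Gay–Kirby 2016, Def. 8 and
Lemma 10).  Everything in this file is **proved**; no definitions, no named facts.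

On the carrier of the stabilisation implant the three faces of the trisection are, in the
chart `Θ`, **graphs** `x₃ = M(x₀, x₁, x₂)` over (an open subset of) `ℝ³` (`M = N`, `-N` or `0`,
`N` the birth function, `TrisectionsImplantModelFaces.lean`), and the collar function of the
face restricted to the graph is an affine function `a₀ + b₀ · N` of the base point.  This file
turns that description into Morse data of the restriction in the slice structure of the face:

* `morseData_translate`, `morseData_const_add_smul_model` — on the model space `ℝⁿ⁺¹`,
  translating the argument or replacing `g` by `a + b g` (`b ≠ 0`) does not change critical
  points or nondegeneracy, keeps the index for `b > 0` and flips it (`index + index = n + 1`)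
  for `b < 0`;
* `exists_shearChart` — the shear `(x₀ - a, x₁, x₂, x₃ - M(x₀, x₁, x₂))` composed with `Θ` is
  a boundary slice chart of the graph face with positive `0`-th coordinate near a given
  point;
* `morseData_graphFace` — in the structure of any boundary slice atlas of the face, the Morse
  data of the collar function at a point of the graph are those of `N` at the base point (index
  flipped when `b₀ < 0`).

## References

* D. Gay, R. Kirby, *Trisecting 4-manifolds*, Geom. Topol. 20 (2016), proof of Lemma 10.
  [GayKirby2016]
* J. Milnor, *Morse theory* (1963), §2; *Lectures on the h-cobordism theorem* (1965),
  Lemma 8.2 and proof of Thm. 9.1. [Milnor1963] [MilnorHCobordism1965]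
-/

open scoped Manifold ContDiff Topology
open Set Function Filter

noncomputable section

namespace Literature.Topology.FourManifolds

universe u

/-! ### Model-space lemmas -/

section ModelSpace

variable {n : ℕ}

/-- **Translation invariance of Morse data on the model space.** [cite: Milnor1963, §2] -/
theorem morseData_translate (h : EuclideanSpace ℝ (Fin (n + 1)) → ℝ)
    (c u : EuclideanSpace ℝ (Fin (n + 1))) :
    (IsMCriticalPt (𝓡 (n + 1)) (fun v => h (v + c)) u ↔ IsMCriticalPt (𝓡 (n + 1)) h (u + c)) ∧
    mhessian (𝓡 (n + 1)) (fun v => h (v + c)) u = mhessian (𝓡 (n + 1)) h (u + c) := by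
  have hfd : fderiv ℝ (fun v => h (v + c)) = fun v => fderiv ℝ h (v + c) := by
    funext v; exact fderiv_comp_add_right c
  have hfd2 : fderiv ℝ (fderiv ℝ (fun v => h (v + c))) u = fderiv ℝ (fderiv ℝ h) (u + c) := by
    rw [hfd]; exact fderiv_comp_add_right c
  refine ⟨?_, ?_⟩
  · rw [MorseBirth.isMCriticalPt_iff_fderiv, MorseBirth.isMCriticalPt_iff_fderiv, hfd]
  · ext v w
    rw [MorseBirth.mhessian_model_apply, MorseBirth.mhessian_model_apply, hfd2]

/-- **`a + b g` has the critical points and nondegeneracy of `g`, the same index for `b > 0`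
and the flipped index for `b < 0`** (model space `ℝⁿ⁺¹`). [cite: Milnor1963, §2;
MilnorHCobordism1965, proof of Thm. 9.1] -/
theorem morseData_const_add_smul_model {g : EuclideanSpace ℝ (Fin (n + 1)) → ℝ}
    (hg : ContDiff ℝ 2 g) {a b : ℝ} (hb : b ≠ 0) (z : EuclideanSpace ℝ (Fin (n + 1))) :
    (IsMCriticalPt (𝓡 (n + 1)) (fun y => a + b * g y) z ↔ IsMCriticalPt (𝓡 (n + 1)) g z) ∧
    ((mhessian (𝓡 (n + 1)) (fun y => a + b * g y) z).Nondegenerate ↔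
      (mhessian (𝓡 (n + 1)) g z).Nondegenerate) ∧
    (0 < b → morseIndex (𝓡 (n + 1)) (fun y => a + b * g y) z = morseIndex (𝓡 (n + 1)) g z) ∧
    (b < 0 → (mhessian (𝓡 (n + 1)) g z).Nondegenerate →
      morseIndex (𝓡 (n + 1)) (fun y => a + b * g y) z + morseIndex (𝓡 (n + 1)) g z = n + 1) := by
  have hgd : Differentiable ℝ g := hg.differentiable (by norm_num)
  have hfd : ∀ y, fderiv ℝ (fun y => a + b * g y) y = b • fderiv ℝ g y := by
    intro y
    have h := ((hgd y).hasFDerivAt.const_mul b).const_add a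
    rw [h.fderiv]
  have hfd' : fderiv ℝ (fun y => a + b * g y) = fun y => b • fderiv ℝ g y := funext hfd
  have hg2 : Differentiable ℝ (fderiv ℝ g) :=
    (hg.fderiv_right (m := 1) (by norm_num)).differentiable (by simp)
  have hfd2 : fderiv ℝ (fderiv ℝ (fun y => a + b * g y)) z = b • fderiv ℝ (fderiv ℝ g) z := by
    rw [hfd']
    exact ((hg2 z).hasFDerivAt.const_smul b).fderiv
  have hBeq : mhessian (𝓡 (n + 1)) (fun y => a + b * g y) z = b • mhessian (𝓡 (n + 1)) g z := by
    ext v w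
    rw [MorseBirth.mhessian_model_apply, hfd2]
    simp only [smul_apply, LinearMap.smul_apply, MorseBirth.mhessian_model_apply, smul_eq_mul]
  refine ⟨?_, ?_, fun hbpos => ?_, fun hbneg hnd => ?_⟩
  · rw [MorseBirth.isMCriticalPt_iff_fderiv, MorseBirth.isMCriticalPt_iff_fderiv, hfd, smul_eq_zero]
    simp [hb]
  · rw [hBeq]; exact LinearMap.BilinForm.nondegenerate_smul_iff _ hb
  · unfold morseIndex
    rw [hBeq]
    exact LinearMap.BilinForm.sigNeg_smul_of_pos' _ hbpos
  · unfold morseIndex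
    rw [hBeq]
    have hsymm : (mhessian (𝓡 (n + 1)) g z).IsSymm :=
      LinearMap.BilinForm.isSymm_iff.2 (mhessian_isSymm_holds (I := 𝓡 (n + 1)) (contMDiff_iff_contDiff.2 hg) z)
    have h := LinearMap.BilinForm.sigNeg_smul_of_neg hnd hsymm hbneg
    rw [finrank_euclideanSpace_fin] at h
    exact h

end ModelSpace

/-! ### Shear charts of a graph face -/

section Shear

variable {X : Type u} [TopologicalSpace X] [ChartedSpace (EuclideanSpace ℝ (Fin 4)) X]
  [IsManifold (𝓡 4) ∞ X]

/-- **The shear chart of a graph face.**  Let `Θ` be a chart of the maximal atlas and suppose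
that on the open `V ⊆ Θ.source` the set `Q'` is the graph `{(Θ q)₃ = M (dropLast (Θ q))}` of
a smooth `M : ℝ³ → ℝ`.  Then near any `y ∈ V` the shear
`q ↦ (dropLast (Θ q) - a e₀, (Θ q)₃ - M (dropLast (Θ q)))`, `a = (Θ y)₀ - 1`, is a boundary
slice chart of `Q'` with positive `0`-th coordinate, whose inverse on the slice is
`(u, 0) ↦ Θ⁻¹ (u + a e₀, M (u + a e₀))`. [cite: LeeSmoothManifolds2013, Thm. 5.51] -/
theorem exists_shearChart {Θ : OpenPartialHomeomorph X (EuclideanSpace ℝ (Fin 4))}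
    (hΘ : Θ ∈ IsManifold.maximalAtlas (𝓡 4) ∞ X) {M : EuclideanSpace ℝ (Fin 3) → ℝ}
    (hM : ContDiff ℝ ∞ M) {Q' V : Set X} (hVo : IsOpen V) (hVsrc : V ⊆ Θ.source)
    (hgraph : ∀ q ∈ V, q ∈ Q' ↔ Θ q 3 = M (dropLast 2 (Θ q))) {y : X} (hyV : y ∈ V) :
    ∃ D : BoundarySliceChart 2 Q', y ∈ D.Θ.source ∧ D.Θ.source ⊆ V ∧
      (∀ q ∈ D.Θ.source, 0 < D.Θ q 0) ∧
      (∀ q ∈ D.Θ.source, dropLast 2 (D.Θ q) =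
        dropLast 2 (Θ q) - (Θ y 0 - 1) • EuclideanSpace.single 0 1) ∧
      (∀ q ∈ D.Θ.source, D.Θ q (Fin.last 3) = Θ q 3 - M (dropLast 2 (Θ q))) ∧
      ∀ u : EuclideanSpace ℝ (Fin 3), snocEquiv 3 (u, 0) ∈ D.Θ.target →
        D.Θ.symm (snocEquiv 3 (u, 0)) =
          Θ.symm (snocEquiv 3 (u + (Θ y 0 - 1) • EuclideanSpace.single 0 1,
            M (u + (Θ y 0 - 1) • EuclideanSpace.single 0 1))) := by
  set a : ℝ := Θ y 0 - 1 with ha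
  set e₀ : EuclideanSpace ℝ (Fin 3) := EuclideanSpace.single 0 1 with he₀
  -- the shear of `ℝ⁴`
  set ξ : EuclideanSpace ℝ (Fin 4) → EuclideanSpace ℝ (Fin 4) :=
    fun x => snocEquiv 3 (dropLast 2 x - a • e₀, x 3 - M (dropLast 2 x)) with hξ
  set ξi : EuclideanSpace ℝ (Fin 4) → EuclideanSpace ℝ (Fin 4) :=
    fun w => snocEquiv 3 (dropLast 2 w + a • e₀, w 3 + M (dropLast 2 w + a • e₀)) with hξi
  have h3 : ∀ (p : EuclideanSpace ℝ (Fin 3)) (t : ℝ), snocEquiv 3 (p, t) 3 = t := fun p t =>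
    snocEquiv_apply_last 3 (p, t)
  have hξs : ContDiff ℝ ∞ ξ := by
    refine (snocEquiv 3).contDiff.comp (ContDiff.prodMk ?_ ?_)
    · exact ((dropLast 2).contDiff.sub contDiff_const)
    · exact (contDiff_apply ℝ ℝ (3 : Fin 4) |>.comp (PiLp.contDiff_ofLp (p := 2))).sub (hM.comp (dropLast 2).contDiff)
  have hξis : ContDiff ℝ ∞ ξi := by
    refine (snocEquiv 3).contDiff.comp (ContDiff.prodMk ?_ ?_)
    · exact ((dropLast 2).contDiff.add contDiff_const)
    · exact (contDiff_apply ℝ ℝ (3 : Fin 4) |>.comp (PiLp.contDiff_ofLp (p := 2))).add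
        (hM.comp ((dropLast 2).contDiff.add contDiff_const))
  have hleft : ∀ x, ξi (ξ x) = x := by
    intro x
    simp only [hξ, hξi, dropLast_snocEquiv, h3, sub_add_cancel]
    -- `snoc (dropLast x, x 3) = x`
    have hx : snocEquiv 3 (dropLast 2 x, x (Fin.last 3)) = x := by
      have h1 : (dropLast 2 x, x (Fin.last 3)) = (snocEquiv 3).symm x :=
        Prod.ext (by rw [dropLast_apply]) (by rw [snocEquiv_symm_apply_snd])
      rw [h1, ContinuousLinearEquiv.apply_symm_apply]
    exact hx
  have hright : ∀ w, ξ (ξi w) = w := by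
    intro w
    simp only [hξ, hξi, dropLast_snocEquiv, h3, add_sub_cancel_right]
    have hw : snocEquiv 3 (dropLast 2 w, w (Fin.last 3)) = w := by
      have h1 : (dropLast 2 w, w (Fin.last 3)) = (snocEquiv 3).symm w :=
        Prod.ext (by rw [dropLast_apply]) (by rw [snocEquiv_symm_apply_snd])
      rw [h1, ContinuousLinearEquiv.apply_symm_apply]
    exact hw
  set Ξ : EuclideanSpace ℝ (Fin 4) ≃ₜ EuclideanSpace ℝ (Fin 4) :=
    { toFun := ξ, invFun := ξi, left_inv := hleft, right_inv := hright,
      continuous_toFun := hξs.continuous, continuous_invFun := hξis.continuous } with hΞ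
  have hΞmem : Ξ.toOpenPartialHomeomorph ∈ contDiffGroupoid ∞ (𝓡 4) :=
    contDiffGroupoid_mem_of_contDiffOn_symm hξs.contDiffOn hξis.contDiffOn
  set Θ₁ : OpenPartialHomeomorph X (EuclideanSpace ℝ (Fin 4)) := Θ.trans Ξ.toOpenPartialHomeomorph with hΘ₁
  have hΘ₁mem : Θ₁ ∈ IsManifold.maximalAtlas (𝓡 4) ∞ X := trans_mem_maximalAtlas hΘ hΞmem
  have hΘ₁src : Θ₁.source = Θ.source := by rw [hΘ₁, OpenPartialHomeomorph.trans_source]; simp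
  have hΘ₁apply : ∀ q, Θ₁ q = ξ (Θ q) := fun q => rfl
  have hΘ₁symm : ∀ w, Θ₁.symm w = Θ.symm (ξi w) := fun w => rfl
  -- the source
  set Src : Set X := V ∩ (Θ.source ∩ Θ ⁻¹' {x | 0 < x 0 - a}) with hSrc
  have hSrco : IsOpen Src := hVo.inter (Θ.continuousOn.isOpen_inter_preimage Θ.open_source
    (isOpen_lt continuous_const ((EuclideanSpace.proj (0 : Fin 4)).continuous.sub continuous_const)))
  have hySrc : y ∈ Src := ⟨hyV, hVsrc hyV, by show 0 < Θ y 0 - a; rw [ha]; norm_num⟩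
  set Θ₂ := Θ₁.restr Src with hΘ₂
  have hΘ₂mem : Θ₂ ∈ IsManifold.maximalAtlas (𝓡 4) ∞ X := restr_mem_maximalAtlas _ hΘ₁mem hSrco
  have hΘ₂src : Θ₂.source = Θ.source ∩ Src := by
    rw [hΘ₂, OpenPartialHomeomorph.restr_source, hSrco.interior_eq, hΘ₁src]
  have hΘ₂apply : ∀ q, Θ₂ q = ξ (Θ q) := fun q => rfl
  have hΘ₂symm : ∀ w, Θ₂.symm w = Θ.symm (ξi w) := fun w => rfl
  have hcoord0 : ∀ q, ξ (Θ q) 0 = Θ q 0 - a := by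
    intro q
    simp only [hξ]
    rw [snocEquiv_apply_zero]
    simp [he₀, dropLast_apply_zero]
  have hcoordlast : ∀ q, ξ (Θ q) (Fin.last 3) = Θ q 3 - M (dropLast 2 (Θ q)) := by
    intro q; simp only [hξ]; exact snocEquiv_apply_last 3 _
  refine ⟨{ Θ := Θ₂
            contMDiffOn_toFun := contMDiffOn_of_mem_maximalAtlas hΘ₂mem
            contMDiffOn_symm := contMDiffOn_symm_of_mem_maximalAtlas hΘ₂mem
            mem_iff := fun q hq => ?_ }, ?_, ?_, ?_, ?_, ?_, ?_⟩
  · rw [hΘ₂src] at hq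
    obtain ⟨-, hqV, -, hq0⟩ := hq
    have hq0' : 0 < Θ q 0 - a := hq0
    rw [hgraph q hqV, hΘ₂apply, hcoordlast, hcoord0, sub_eq_zero]
    exact ⟨fun h => ⟨h, hq0'.le⟩, fun h => h.1⟩
  · show y ∈ Θ₂.source
    rw [hΘ₂src]; exact ⟨hVsrc hyV, hySrc⟩
  · show Θ₂.source ⊆ V
    rw [hΘ₂src]; exact fun q hq => hq.2.1
  · intro q hq
    show 0 < Θ₂ q 0
    have hq' : q ∈ Θ₂.source := hq
    rw [hΘ₂src] at hq'
    rw [hΘ₂apply, hcoord0]; exact hq'.2.2.2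
  · intro q _
    show dropLast 2 (Θ₂ q) = dropLast 2 (Θ q) - a • EuclideanSpace.single 0 1
    rw [hΘ₂apply]; simp only [hξ, dropLast_snocEquiv, he₀]
  · intro q _
    show Θ₂ q (Fin.last 3) = _
    rw [hΘ₂apply, hcoordlast]
  · intro u _
    show Θ₂.symm (snocEquiv 3 (u, 0)) = _
    rw [hΘ₂symm]
    simp only [hξi, dropLast_snocEquiv, h3, zero_add]

/-- **Morse data of the collar function on a graph face.**  Let `Θ`, `M`, `V`, `Q'` be as in
`exists_shearChart`, and let the smooth `f` satisfy `f q = a₀ + b₀ · Nf (dropLast (Θ q))` at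
the points of the face in `V` (`b₀ ≠ 0`, `Nf` smooth).  Then, in the structure of any boundary
slice atlas of `Q'`, at `y ∈ Q' ∩ V` the function `f|Q'` is critical iff the base point
`dropLast (Θ y)` is critical for `Nf`, and then it is nondegenerate iff `Nf` is, with the same
index if `b₀ > 0` and the flipped index (`index + index = 3`) if `b₀ < 0`.
[cite: GayKirby2016, proof of Lemma 10; Milnor1963, §2] -/
theorem morseData_graphFace {Θ : OpenPartialHomeomorph X (EuclideanSpace ℝ (Fin 4))}
    (hΘ : Θ ∈ IsManifold.maximalAtlas (𝓡 4) ∞ X) {M : EuclideanSpace ℝ (Fin 3) → ℝ}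
    (hM : ContDiff ℝ ∞ M) {Q' V : Set X} (Φ' : BoundarySliceAtlas 2 Q') (hVo : IsOpen V)
    (hVsrc : V ⊆ Θ.source) (hgraph : ∀ q ∈ V, q ∈ Q' ↔ Θ q 3 = M (dropLast 2 (Θ q)))
    {f : X → ℝ} (hf : ContMDiff (𝓡 4) 𝓘(ℝ, ℝ) ∞ f) {Nf : EuclideanSpace ℝ (Fin 3) → ℝ}
    (hNf : ContDiff ℝ ∞ Nf) {a₀ b₀ : ℝ} (hb₀ : b₀ ≠ 0)
    (hformula : ∀ q ∈ V, q ∈ Q' → f q = a₀ + b₀ * Nf (dropLast 2 (Θ q)))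
    {y : X} (hyV : y ∈ V) (hyQ : y ∈ Q') :
    ∃ D : BoundarySliceChart 2 Q', y ∈ D.Θ.source ∧ D.Θ.source ⊆ V ∧
      (∀ q ∈ D.Θ.source, 0 < D.Θ q 0) ∧
      letI := Φ'.chartedSpace
      (IsMCriticalPt (𝓡∂ 3) (f ∘ Subtype.val : ↥Q' → ℝ) ⟨y, hyQ⟩ ↔
        IsMCriticalPt (𝓡 3) Nf (dropLast 2 (Θ y))) ∧
      (IsMCriticalPt (𝓡∂ 3) (f ∘ Subtype.val : ↥Q' → ℝ) ⟨y, hyQ⟩ →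
        ((mhessian (𝓡∂ 3) (f ∘ Subtype.val : ↥Q' → ℝ) ⟨y, hyQ⟩).Nondegenerate ↔
          (mhessian (𝓡 3) Nf (dropLast 2 (Θ y))).Nondegenerate) ∧
        (0 < b₀ → morseIndex (𝓡∂ 3) (f ∘ Subtype.val : ↥Q' → ℝ) ⟨y, hyQ⟩ =
          morseIndex (𝓡 3) Nf (dropLast 2 (Θ y))) ∧
        (b₀ < 0 → (mhessian (𝓡 3) Nf (dropLast 2 (Θ y))).Nondegenerate →
          morseIndex (𝓡∂ 3) (f ∘ Subtype.val : ↥Q' → ℝ) ⟨y, hyQ⟩ +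
            morseIndex (𝓡 3) Nf (dropLast 2 (Θ y)) = 3)) := by
  letI := Φ'.chartedSpace
  obtain ⟨D, hyD, hDV, hpos, hdrop, hlast, hsymm⟩ := exists_shearChart hΘ hM hVo hVsrc hgraph hyV
  set a : ℝ := Θ y 0 - 1 with ha
  set e₀ : EuclideanSpace ℝ (Fin 3) := EuclideanSpace.single 0 1 with he₀
  set zb : EuclideanSpace ℝ (Fin 3) := dropLast 2 (Θ y) with hzb
  set uy : EuclideanSpace ℝ (Fin 3) := dropLast 2 (D.Θ y) with huy
  have huyzb : uy + a • e₀ = zb := by rw [huy, hdrop y hyD]; simp [hzb, ha, he₀]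
  -- the model function and the written function
  set g : EuclideanSpace ℝ (Fin 3) → ℝ := fun u => a₀ + b₀ * Nf (u + a • e₀) with hg
  have heq : (fun u => f (D.Θ.symm (snocEquiv 3 (u, 0)))) =ᶠ[𝓝 uy] g := by
    have hT : ∀ᶠ u in 𝓝 uy, snocEquiv 3 (u, 0) ∈ D.Θ.target := by
      have hc : Continuous fun u : EuclideanSpace ℝ (Fin 3) => snocEquiv 3 (u, (0:ℝ)) :=
        (snocEquiv 3).continuous.comp (continuous_id.prodMk continuous_const)
      apply hc.continuousAt.preimage_mem_nhds
      have : snocEquiv 3 (uy, 0) = D.Θ y := D.snocEquiv_dropLast_apply hyD hyQ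
      rw [this]; exact D.Θ.open_target.mem_nhds (D.Θ.map_source hyD)
    filter_upwards [hT] with u hu
    set q := D.Θ.symm (snocEquiv 3 (u, 0)) with hq
    have hqsrc : q ∈ D.Θ.source := D.Θ.map_target hu
    have hqV : q ∈ V := hDV hqsrc
    have hΘu : D.Θ q = snocEquiv 3 (u, 0) := by rw [hq]; exact D.Θ.right_inv hu
    have hqQ : q ∈ Q' := by
      rw [D.mem_iff q hqsrc, hΘu]
      refine ⟨snocEquiv_apply_last 3 _, ?_⟩
      have h0 := hpos q hqsrc
      rw [hΘu] at h0
      exact h0.le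
    have hΘq : dropLast 2 (Θ q) = u + a • e₀ := by
      have h1 := hdrop q hqsrc
      rw [hΘu, dropLast_snocEquiv] at h1
      rw [h1]; abel
    show f q = a₀ + b₀ * Nf (u + a • e₀)
    rw [hformula q hqV hqQ, hΘq]
  obtain ⟨h1, h2⟩ := morseData_face_of_written Φ' D hyQ hyD (hpos y hyD) hf heq
  -- the Morse data of `g` at `uy` are those of `Nf` at `zb`
  have hNf2 : ContDiff ℝ 2 Nf := hNf.of_le (by norm_cast)
  obtain ⟨ht1, ht2⟩ := morseData_translate (n := 2) (fun v => a₀ + b₀ * Nf v) (a • e₀) uy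
  obtain ⟨hs1, hs2, hs3, hs4⟩ := morseData_const_add_smul_model (n := 2) hNf2 (a := a₀) hb₀ zb
  rw [huyzb] at ht1 ht2
  refine ⟨D, hyD, hDV, hpos, ?_, fun hcrit => ?_⟩
  · rw [h1, show IsMCriticalPt (𝓡 3) g uy ↔ IsMCriticalPt (𝓡 3) (fun v => a₀ + b₀ * Nf v) zb from ht1, hs1]
  · obtain ⟨h2a, h2b⟩ := h2 hcrit
    have hmg : mhessian (𝓡 3) g uy = mhessian (𝓡 3) (fun v => a₀ + b₀ * Nf v) zb := ht2
    have hig : morseIndex (𝓡 3) g uy = morseIndex (𝓡 3) (fun v => a₀ + b₀ * Nf v) zb := by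
      unfold morseIndex; rw [hmg]
    refine ⟨by rw [h2a, hmg, hs2], fun hb => by rw [h2b, hig, hs3 hb], fun hb hnd => ?_⟩
    rw [h2b, hig]; exact hs4 hb hnd

end Shear

end Literature.Topology.FourManifolds
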